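import Summits.HubbardSuperconductivity.HubbardSuperconductivity.Theorems.AnisotropyChordChordXYGroundStateLimit

/-!
# Route `AnisotropyChord`, crux `ChordXY` (stmt-HubbardSuperconductivity-8146): the CANONICAL SECTOR
# CONDENSATE `Λ_{β,M}(Δ)` — definitions of the registered skeleton, and the registered stub
# `stub_groundStateLimit` BY NAME

The `ChordXY` birth skeleton (sha `c9438cf6…`, = `Cruxes/ChordFM/Lines/thermal_af.lean` of the parent crux
`ChordFM`, stmt-8147) routes the chord `(1+Δ)·Λ(ψ₀) ≤ Λ(ψ)` through the finite-temperature condensate of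
the half-filled sector. Its three statement abbreviations are landed here VERBATIM so that the skeleton's
stubs can be closed by name in `Theorems/`:

* `sectorProj M` — the orthogonal projection `P₀` onto the half-filled sector `S^z_tot = 0` of the spin-½
  torus of side `M` (`projMatrix` of `spinZSector 1 0` transported to `EuclideanSpace`, the Literature's
  convention of `FinDimSpectrumSectorGibbsLimit`);
* `condensateOp M` — `A = S⁺_tot S⁻_tot`;
* `thermalCondensate M β Δ = Re( tr(P₀ e^{-βH_M(Δ)} A) / tr(P₀ e^{-βH_M(Δ)}) )`,
  `H_M(Δ) = xxzHamiltonian 1 (torusGraph 2 M) (-1) Δ`, `e^{-βH} = Matrix.gibbsWeight β H` — the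
  condensate of the canonical (sector) Gibbs state;

and the registered stub

* `stub_groundStateLimit` — `Λ_{β,M}(Δ) ⟶ Re⟨ψ, S⁺_tot S⁻_tot ψ⟩` as `β → ∞` for every normalised sector
  ground state `ψ` of `H_M(Δ)` (every real `Δ`, `M ≥ 2`): the defs unfolded, this is the landed
  `tendsto_thermalCondensate_groundState` (`…ChordXYGroundStateLimit`: zero-temperature limit of the
  sector Gibbs state `tendsto_sectorGibbsAverage_atTop` + Perron–Frobenius uniqueness of the sector
  ground state `xxzSpin_sector_perron_of_connected`).

The other registered stub `stub_thermalChordAF` (the thermal chord, eventually in `β`) is the open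
engine statement and is NOT touched here. Sources: H. Tasaki, *Physics and Mathematics of Quantum
Many-Body Systems* (2020) §2.2, App. A.2; O. Bratteli, D. W. Robinson, *Operator Algebras and Quantum
Statistical Mechanics II* §5.3.1. The definitions are statement abbreviations (no mathematical content).
-/

set_option linter.dupNamespace false

noncomputable section

namespace Summit.HubbardSuperconductivity.HubbardSuperconductivity.Theorems.AnisotropyChord

open Matrix Filter Topology
open Literature.MathematicalPhysics.QuantumLattice Literature.Probability.LatticeModels

/-- The orthogonal projection `P₀` onto the half-filled sector `S^z_tot = 0` of the spin-½ torus of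
side `M` (`projMatrix` of the sector transported to `EuclideanSpace`, the Literature's convention) —
verbatim the `ChordXY`/`ChordFM` skeleton's `sectorProj`. Tasaki (2020) App. A.2. [folklore] -/
def sectorProj (M : ℕ) [NeZero M] :
    Matrix (TensorIndex (TorusSite 2 M) 2) (TensorIndex (TorusSite 2 M) 2) ℂ :=
  projMatrix ((spinZSector (Λ := TorusSite 2 M) 1 0).map
    ((WithLp.linearEquiv 2 ℂ (TensorIndex (TorusSite 2 M) 2 → ℂ)).symm :
      (TensorIndex (TorusSite 2 M) 2 → ℂ) →ₗ[ℂ] EuclideanSpace ℂ (TensorIndex (TorusSite 2 M) 2)))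

/-- The condensate operator `A = S⁺_tot S⁻_tot` of the spin-½ torus of side `M` — verbatim the
skeleton's `condensateOp`. Kennedy–Lieb–Shastry (1988). [folklore] -/
def condensateOp (M : ℕ) [NeZero M] :
    Matrix (TensorIndex (TorusSite 2 M) 2) (TensorIndex (TorusSite 2 M) 2) ℂ :=
  (∑ x : TorusSite 2 M, onSite x (spinRaise 1)) * (∑ y : TorusSite 2 M, onSite y (spinLower 1))

/-- **The finite-temperature condensate of the half-filled sector**,
`Λ_{β,M}(Δ) = Re( tr(P₀ e^{-β H_M(Δ)} S⁺_tot S⁻_tot) / tr(P₀ e^{-β H_M(Δ)}) )` with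
`H_M(Δ) = xxzHamiltonian 1 (torusGraph 2 M) (-1) Δ` — verbatim the skeleton's `thermalCondensate`.
Bratteli–Robinson II §5.3.1 (canonical Gibbs state of a sector). [folklore] -/
def thermalCondensate (M : ℕ) [NeZero M] (β Δ : ℝ) : ℝ :=
  ((sectorProj M * gibbsWeight β (xxzHamiltonian 1 (torusGraph 2 M) (-1) Δ) * condensateOp M).trace /
    (sectorProj M * gibbsWeight β (xxzHamiltonian 1 (torusGraph 2 M) (-1) Δ)).trace).re

/-- Unfolding lemma for `sectorProj`. [bookkeeping] -/
theorem sectorProj_eq (M : ℕ) [NeZero M] :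
    sectorProj M = projMatrix ((spinZSector (Λ := TorusSite 2 M) 1 0).map
      ((WithLp.linearEquiv 2 ℂ (TensorIndex (TorusSite 2 M) 2 → ℂ)).symm :
        (TensorIndex (TorusSite 2 M) 2 → ℂ) →ₗ[ℂ] EuclideanSpace ℂ (TensorIndex (TorusSite 2 M) 2))) :=
  rfl

/-- Unfolding lemma for `condensateOp`. [bookkeeping] -/
theorem condensateOp_eq (M : ℕ) [NeZero M] :
    condensateOp M =
      (∑ x : TorusSite 2 M, onSite x (spinRaise 1)) * (∑ y : TorusSite 2 M, onSite y (spinLower 1)) :=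
  rfl

/-- Unfolding lemma for `thermalCondensate`. [bookkeeping] -/
theorem thermalCondensate_eq (M : ℕ) [NeZero M] (β Δ : ℝ) :
    thermalCondensate M β Δ =
      ((sectorProj M * gibbsWeight β (xxzHamiltonian 1 (torusGraph 2 M) (-1) Δ) * condensateOp M).trace /
        (sectorProj M * gibbsWeight β (xxzHamiltonian 1 (torusGraph 2 M) (-1) Δ)).trace).re :=
  rfl

/-- **Registered stub `stub_groundStateLimit` (ChordXY skeleton `c9438cf6…`, ChordFM line `thermal_af`),
BY NAME — the ground-state limit of the canonical sector condensate**: for `M ≥ 2`, every real `Δ` and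
every normalised `S^z_tot = 0` sector ground state `ψ` of `H_M(Δ)`, `Λ_{β,M}(Δ) ⟶ Re⟨ψ, S⁺_tot S⁻_tot ψ⟩`
as `β → ∞` (`tendsto_thermalCondensate_groundState` with the defs unfolded; Perron–Frobenius uniqueness
of the sector ground state identifies the limit). Tasaki (2020) §2.2, App. A.2; Bratteli–Robinson II
§5.3.1. [folklore] -/
theorem stub_groundStateLimit : ∀ (M : ℕ) [NeZero M], Even M → 2 ≤ M → ∀ (Δ : ℝ) (ψ : TensorIndex (TorusSite 2 M) 2 → ℂ), ψ ∈ spinZSector (Λ := TorusSite 2 M) 1 0 → star ψ ⬝ᵥ ψ = 1 → Matrix.mulVec (xxzHamiltonian 1 (torusGraph 2 M) (-1) Δ) ψ = ((lowestEnergyInSector 1 (xxzHamiltonian 1 (torusGraph 2 M) (-1) Δ) 0 : ℝ) : ℂ) • ψ → Tendsto (fun β : ℝ => thermalCondensate M β Δ) atTop (𝓝 ((star ψ ⬝ᵥ Matrix.mulVec ((∑ x : TorusSite 2 M, onSite x (spinRaise 1)) * (∑ y : TorusSite 2 M, onSite y (spinLower 1))) ψ).re)) := by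
  intro M _ hE h2 Δ ψ hmem hψ1 heig
  unfold thermalCondensate sectorProj condensateOp
  exact tendsto_thermalCondensate_groundState M hE h2 Δ ψ hmem hψ1 heig

end Summit.HubbardSuperconductivity.HubbardSuperconductivity.Theorems.AnisotropyChord

end
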